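import Mathlib.Analysis.SpecialFunctions.SmoothTransition
import Mathlib.Analysis.Calculus.IteratedDeriv.Lemmas
import Mathlib.Analysis.Calculus.Deriv.Support
import Mathlib.Analysis.Normed.Group.Bounded
import Mathlib.Tactic.IntervalCases
import HarnessLib

/-!
# Conrey–Iwaniec (2002), Theorem 6.1: the smooth `ρ`-adic partition of unity behind (6.27)

B. Conrey, H. Iwaniec, *Spacing of zeros of Hecke `L`-functions and the class number problem*,
Acta Arith. 103 (2002) 259–312, §6, proof of (6.27) [held text `paper:arxiv-math_0111012`, p0015:L59–63]:
"using a smooth partition of unity with constituents in `m, n` supported in segments of type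
`[Y₁, √2 Y₁]`, `[Y₂, √2 Y₂]` respectively one can justify the applicability of (6.19)".

This file supplies that partition (missing infrastructure MI-3 of the line card of SKELETON P64,
line `thm61-cm-convolution`, stub S2b `stub_thm61_shifted`), for a general ratio `ρ > 1`:

* `psi ρ` — a smooth non-increasing cut-off, `= 1` on `(-∞, 1]`, `= 0` on `[ρ, ∞)`
  (`Real.smoothTransition ((ρ - x)/(ρ - 1))`);
* `plateau ρ u v x = psi ρ (x/v) - psi ρ (x/u)` — for `0 < u ≤ v` a smooth function with values in
  `[0, 1]`, `= 1` on `[ρu, v]`, vanishing off `[u, ρv]`; the constituents of the partition are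
  `η_k = plateau ρ (ρ^k/ρ) (ρ^k)` (support `[ρ^{k-1}, ρ^{k+1}]`), and
  `Σ_{k<N} η_k(x) = psi ρ (ρx/ρ^N) - psi ρ (ρx)` telescopes (`= psi ρ (ρx/ρ^N)` for `x ≥ 1`);
* the scale-invariant derivative bounds `|x|^m |plateau^{(m)}(x)| ≤ ρ²D(1 + (v/u)²)`, `m ≤ 2`,
  with one constant `D = D(ρ) ≥ 1`.

PROVED HERE, no `sorry`; three `def`s (`psi`, `plateau`, nothing else). Used by the proof of the
registered stub S2b (`Thm61ShiftedSum`, file `ConreyIwaniec2002Thm61ShiftedSum.lean`).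

## References
* [ConreyIwaniec2002] B. Conrey, H. Iwaniec, Acta Arith. 103 (2002) 259–312: §6 (6.27).
-/

noncomputable section

open Set Filter
open scoped Topology

namespace Literature.NumberTheory.LFunctions

namespace ConreyIwaniec2002

namespace Thm61Partition

/-! ### The cut-off `ψ_ρ` -/

/-- **The smooth cut-off `ψ_ρ`**: `ψ_ρ(x) = smoothTransition((ρ - x)/(ρ - 1))`, equal to `1` for
`x ≤ 1` and to `0` for `x ≥ ρ`. [cite: ConreyIwaniec2002, §6 (6.27)] -/
def psi (ρ x : ℝ) : ℝ := Real.smoothTransition ((ρ - x) / (ρ - 1))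

/-- `ψ_ρ(x) = 1` for `x ≤ 1`. [cite: ConreyIwaniec2002, §6 (6.27)] -/
theorem psi_eq_one {ρ : ℝ} (hρ : 1 < ρ) {x : ℝ} (hx : x ≤ 1) : psi ρ x = 1 :=
  Real.smoothTransition.one_of_one_le (by rw [le_div_iff₀ (sub_pos.2 hρ)]; linarith)

/-- `ψ_ρ(x) = 0` for `x ≥ ρ`. [cite: ConreyIwaniec2002, §6 (6.27)] -/
theorem psi_eq_zero {ρ : ℝ} (hρ : 1 < ρ) {x : ℝ} (hx : ρ ≤ x) : psi ρ x = 0 :=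
  Real.smoothTransition.zero_of_nonpos
    (div_nonpos_of_nonpos_of_nonneg (by linarith) (by linarith))

/-- `0 ≤ ψ_ρ`. [cite: ConreyIwaniec2002, §6 (6.27)] -/
theorem psi_nonneg (ρ x : ℝ) : 0 ≤ psi ρ x := Real.smoothTransition.nonneg _

/-- `ψ_ρ ≤ 1`. [cite: ConreyIwaniec2002, §6 (6.27)] -/
theorem psi_le_one (ρ x : ℝ) : psi ρ x ≤ 1 := Real.smoothTransition.le_one _

/-- `ψ_ρ` is non-increasing. [cite: ConreyIwaniec2002, §6 (6.27)] -/
theorem psi_antitone {ρ : ℝ} (hρ : 1 < ρ) : Antitone (psi ρ) := fun _ _ hxy =>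
  Real.smoothTransition.monotone (div_le_div_of_nonneg_right (by linarith) (sub_pos.2 hρ).le)

/-- `ψ_ρ` is smooth. [cite: ConreyIwaniec2002, §6 (6.27)] -/
theorem psi_contDiff (ρ : ℝ) {n : ℕ∞} : ContDiff ℝ n (psi ρ) :=
  Real.smoothTransition.contDiff.comp ((contDiff_const.sub contDiff_id).div_const _)

/-- `ψ_ρ` is continuous. [cite: ConreyIwaniec2002, §6 (6.27)] -/
theorem psi_continuous (ρ : ℝ) : Continuous (psi ρ) := (psi_contDiff ρ (n := 0)).continuous

/-- All derivatives of `ψ_ρ` of positive order vanish off `[1, ρ]`.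
[cite: ConreyIwaniec2002, §6 (6.27)] -/
theorem iteratedDeriv_psi_eq_zero {ρ : ℝ} (hρ : 1 < ρ) {m : ℕ} (hm : m ≠ 0) {x : ℝ}
    (hx : x ∉ Icc 1 ρ) : iteratedDeriv m (psi ρ) x = 0 := by
  rw [mem_Icc, not_and_or, not_le, not_le] at hx
  rcases hx with hx | hx
  · have h : psi ρ =ᶠ[𝓝 x] fun _ => (1 : ℝ) := by
      filter_upwards [Iio_mem_nhds hx] with y hy using psi_eq_one hρ hy.le
    rw [(h.iteratedDeriv m).eq_of_nhds, iteratedDeriv_const, if_neg hm]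
  · have h : psi ρ =ᶠ[𝓝 x] fun _ => (0 : ℝ) := by
      filter_upwards [Ioi_mem_nhds hx] with y hy using psi_eq_zero hρ hy.le
    rw [(h.iteratedDeriv m).eq_of_nhds, iteratedDeriv_const, if_neg hm]

/-- One constant `D = D(ρ) ≥ 1` bounding `ψ_ρ, ψ_ρ', ψ_ρ''` on `ℝ` (the derivatives are continuous
and supported in `[1, ρ]`). [cite: ConreyIwaniec2002, §6 (6.27)] -/
theorem exists_bound_iteratedDeriv_psi {ρ : ℝ} (hρ : 1 < ρ) :
    ∃ D : ℝ, 1 ≤ D ∧ ∀ m : ℕ, m ≤ 2 → ∀ x : ℝ, |iteratedDeriv m (psi ρ) x| ≤ D := by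
  have hc : ∀ m : ℕ, Continuous (iteratedDeriv m (psi ρ)) := fun m =>
    (psi_contDiff ρ (n := m)).continuous_iteratedDeriv m le_rfl
  have hs : ∀ m : ℕ, m ≠ 0 → HasCompactSupport (iteratedDeriv m (psi ρ)) := fun m hm =>
    HasCompactSupport.intro isCompact_Icc fun x hx => iteratedDeriv_psi_eq_zero hρ hm hx
  obtain ⟨D₁, hD₁⟩ := (hc 1).bounded_above_of_compact_support (hs 1 one_ne_zero)
  obtain ⟨D₂, hD₂⟩ := (hc 2).bounded_above_of_compact_support (hs 2 two_ne_zero)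
  refine ⟨max 1 (max D₁ D₂), le_max_left _ _, fun m hm x => ?_⟩
  interval_cases m
  · rw [iteratedDeriv_zero, abs_of_nonneg (psi_nonneg ρ x)]
    exact (psi_le_one ρ x).trans (le_max_left _ _)
  · exact ((Real.norm_eq_abs _).symm.le.trans (hD₁ x)).trans
      (le_max_of_le_right (le_max_left _ _))
  · exact ((Real.norm_eq_abs _).symm.le.trans (hD₂ x)).trans
      (le_max_of_le_right (le_max_right _ _))

/-! ### Rescaling `x ↦ f(x/v)` and the first two derivatives -/

/-- Auxiliary (proof-internal): `(f(·/v))' = f'(·/v)/v`. [folklore] -/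
private theorem deriv_comp_div {f : ℝ → ℝ} (hf : Differentiable ℝ f) (v : ℝ) :
    deriv (fun x => f (x / v)) = fun x => deriv f (x / v) / v := by
  funext x
  have h : HasDerivAt (fun x => f (x / v)) (deriv f (x / v) * (1 / v)) x :=
    ((hf (x / v)).hasDerivAt).comp x ((hasDerivAt_id x).div_const v)
  rw [h.deriv]; ring

/-- Auxiliary (proof-internal): `m`-th derivative of `x ↦ f(x/v)` for `m ≤ 2` and `f ∈ C²` is
`f^{(m)}(x/v)/v^m`. [folklore] -/
private theorem iteratedDeriv_comp_div {f : ℝ → ℝ} (hf : ContDiff ℝ 2 f) (v : ℝ) {m : ℕ} (hm : m ≤ 2)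
    (x : ℝ) : iteratedDeriv m (fun y => f (y / v)) x = iteratedDeriv m f (x / v) / v ^ m := by
  have hd : Differentiable ℝ f := hf.differentiable (by norm_num)
  have hd' : Differentiable ℝ (deriv f) := by
    have := hf.differentiable_iteratedDeriv 1 (by norm_num)
    rwa [iteratedDeriv_one] at this
  interval_cases m
  · simp
  · rw [iteratedDeriv_one, iteratedDeriv_one, deriv_comp_div hd v, pow_one]
  · rw [iteratedDeriv_succ, iteratedDeriv_one, deriv_comp_div hd v, iteratedDeriv_succ,
      iteratedDeriv_one]
    rw [deriv_div_const, deriv_comp_div hd' v]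
    ring

/-! ### The plateau functions (constituents of the partition and their fattenings) -/

/-- **`plateau ρ u v (x) = ψ_ρ(x/v) − ψ_ρ(x/u)`**: for `0 < u ≤ v` a smooth bump with values in
`[0,1]`, equal to `1` on `[ρu, v]` and to `0` off `[u, ρv]`. The constituents of the smooth
`ρ`-adic partition of unity are `plateau ρ (ρ^k/ρ) (ρ^k)`. [cite: ConreyIwaniec2002, §6 (6.27)] -/
def plateau (ρ u v : ℝ) (x : ℝ) : ℝ := psi ρ (x / v) - psi ρ (x / u)

/-- `plateau` is smooth. [cite: ConreyIwaniec2002, §6 (6.27)] -/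
theorem plateau_contDiff (ρ u v : ℝ) {n : ℕ∞} : ContDiff ℝ n (plateau ρ u v) :=
  ((psi_contDiff ρ).comp (contDiff_id.div_const v)).sub
    ((psi_contDiff ρ).comp (contDiff_id.div_const u))

/-- `plateau` is continuous. [cite: ConreyIwaniec2002, §6 (6.27)] -/
theorem plateau_continuous (ρ u v : ℝ) : Continuous (plateau ρ u v) :=
  (plateau_contDiff ρ u v (n := 0)).continuous

/-- `plateau = 1` on `[ρu, v]`. [cite: ConreyIwaniec2002, §6 (6.27)] -/
theorem plateau_eq_one {ρ u v : ℝ} (hρ : 1 < ρ) (hu : 0 < u) (hv : 0 < v) {x : ℝ}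
    (h1 : ρ * u ≤ x) (h2 : x ≤ v) : plateau ρ u v x = 1 := by
  rw [plateau, psi_eq_one hρ ((div_le_one hv).2 h2), psi_eq_zero hρ ((le_div_iff₀ hu).2 h1),
    sub_zero]

/-- `plateau = 0` on `(-∞, u]`. [cite: ConreyIwaniec2002, §6 (6.27)] -/
theorem plateau_eq_zero_of_le {ρ u v : ℝ} (hρ : 1 < ρ) (hu : 0 < u) (huv : u ≤ v) {x : ℝ}
    (hx : x ≤ u) : plateau ρ u v x = 0 := by
  have hv : 0 < v := lt_of_lt_of_le hu huv
  have h1 : x / u ≤ 1 := (div_le_one hu).2 hx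
  have h2 : x / v ≤ 1 := by
    rw [div_le_one hv]
    rcases le_or_gt x 0 with h | h
    · linarith
    · linarith
  rw [plateau, psi_eq_one hρ h1, psi_eq_one hρ h2, sub_self]

/-- `plateau = 0` on `[ρv, ∞)`. [cite: ConreyIwaniec2002, §6 (6.27)] -/
theorem plateau_eq_zero_of_ge {ρ u v : ℝ} (hρ : 1 < ρ) (hu : 0 < u) (huv : u ≤ v) {x : ℝ}
    (hx : ρ * v ≤ x) : plateau ρ u v x = 0 := by
  have hv : 0 < v := lt_of_lt_of_le hu huv
  have h1 : ρ ≤ x / v := (le_div_iff₀ hv).2 hx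
  have h2 : ρ ≤ x / u := by
    rw [le_div_iff₀ hu]; nlinarith
  rw [plateau, psi_eq_zero hρ h1, psi_eq_zero hρ h2, sub_self]

/-- `plateau` vanishes off `[u, ρv]`. [cite: ConreyIwaniec2002, §6 (6.27)] -/
theorem plateau_eq_zero_of_not_mem {ρ u v : ℝ} (hρ : 1 < ρ) (hu : 0 < u) (huv : u ≤ v) {x : ℝ}
    (hx : x ∉ Icc u (ρ * v)) : plateau ρ u v x = 0 := by
  rw [mem_Icc, not_and_or, not_le, not_le] at hx
  rcases hx with hx | hx
  · exact plateau_eq_zero_of_le hρ hu huv hx.le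
  · exact plateau_eq_zero_of_ge hρ hu huv hx.le

/-- `0 ≤ plateau`. [cite: ConreyIwaniec2002, §6 (6.27)] -/
theorem plateau_nonneg {ρ u v : ℝ} (hρ : 1 < ρ) (hu : 0 < u) (huv : u ≤ v) (x : ℝ) :
    0 ≤ plateau ρ u v x := by
  rcases le_or_gt x 0 with hx | hx
  · rw [plateau_eq_zero_of_le hρ hu huv (hx.trans hu.le)]
  · have hv : 0 < v := lt_of_lt_of_le hu huv
    have : x / v ≤ x / u := div_le_div_of_nonneg_left hx.le hu huv
    exact sub_nonneg.2 (psi_antitone hρ this)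

/-- `plateau ≤ 1`. [cite: ConreyIwaniec2002, §6 (6.27)] -/
theorem plateau_le_one (ρ u v x : ℝ) : plateau ρ u v x ≤ 1 := by
  have := psi_le_one ρ (x / v); have := psi_nonneg ρ (x / u)
  rw [plateau]; linarith

/-- `|plateau| ≤ 1`. [cite: ConreyIwaniec2002, §6 (6.27)] -/
theorem abs_plateau_le_one {ρ u v : ℝ} (hρ : 1 < ρ) (hu : 0 < u) (huv : u ≤ v) (x : ℝ) :
    |plateau ρ u v x| ≤ 1 := by
  rw [abs_of_nonneg (plateau_nonneg hρ hu huv x)]; exact plateau_le_one ρ u v x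

/-- The derivatives of `plateau`: `ψ^{(m)}(x/v)/v^m − ψ^{(m)}(x/u)/u^m` (`m ≤ 2`).
[cite: ConreyIwaniec2002, §6 (6.27)] -/
theorem iteratedDeriv_plateau (ρ u v : ℝ) {m : ℕ} (hm : m ≤ 2) (x : ℝ) :
    iteratedDeriv m (plateau ρ u v) x =
      iteratedDeriv m (psi ρ) (x / v) / v ^ m - iteratedDeriv m (psi ρ) (x / u) / u ^ m := by
  have h2 : ContDiff ℝ 2 (psi ρ) := psi_contDiff ρ
  have hv : ContDiffAt ℝ m (fun y => psi ρ (y / v)) x :=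
    ((psi_contDiff ρ (n := m)).comp (contDiff_id.div_const v)).contDiffAt
  have hu : ContDiffAt ℝ m (fun y => psi ρ (y / u)) x :=
    ((psi_contDiff ρ (n := m)).comp (contDiff_id.div_const u)).contDiffAt
  have : plateau ρ u v = (fun y => psi ρ (y / v)) - fun y => psi ρ (y / u) := rfl
  rw [this, iteratedDeriv_sub hv hu, iteratedDeriv_comp_div h2 v hm, iteratedDeriv_comp_div h2 u hm]

/-- The telescoping identity: `Σ_{k<N} plateau ρ (ρ^k/ρ) (ρ^k) (x) = ψ_ρ(ρx/ρ^N) − ψ_ρ(ρx)`.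
[cite: ConreyIwaniec2002, §6 (6.27)] -/
theorem sum_range_plateau {ρ : ℝ} (hρ : 1 < ρ) (N : ℕ) (x : ℝ) :
    ∑ k ∈ Finset.range N, plateau ρ (ρ ^ k / ρ) (ρ ^ k) x =
      psi ρ (ρ * x / ρ ^ N) - psi ρ (ρ * x) := by
  have hρ0 : ρ ≠ 0 := by positivity
  have h : ∀ k : ℕ, plateau ρ (ρ ^ k / ρ) (ρ ^ k) x =
      psi ρ (ρ * x / ρ ^ (k + 1)) - psi ρ (ρ * x / ρ ^ k) := by
    intro k
    simp only [plateau]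
    congr 2
    · rw [pow_succ]; field_simp
    · field_simp
  simp_rw [h]
  rw [Finset.sum_range_sub (fun i => psi ρ (ρ * x / ρ ^ i)) N, pow_zero, div_one]

/-- For `x ≥ 1` the partial sums of the partition are `ψ_ρ(ρx/ρ^N) ∈ [0,1]`.
[cite: ConreyIwaniec2002, §6 (6.27)] -/
theorem sum_range_plateau_of_one_le {ρ : ℝ} (hρ : 1 < ρ) (N : ℕ) {x : ℝ} (hx : 1 ≤ x) :
    ∑ k ∈ Finset.range N, plateau ρ (ρ ^ k / ρ) (ρ ^ k) x = psi ρ (ρ * x / ρ ^ N) := by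
  rw [sum_range_plateau hρ, psi_eq_zero hρ (x := ρ * x) (by nlinarith), sub_zero]

/-- The partial sums equal `1` as soon as `ρ x ≤ ρ^N` (and `x ≥ 1`).
[cite: ConreyIwaniec2002, §6 (6.27)] -/
theorem sum_range_plateau_eq_one {ρ : ℝ} (hρ : 1 < ρ) {N : ℕ} {x : ℝ} (hx : 1 ≤ x)
    (hN : ρ * x ≤ ρ ^ N) : ∑ k ∈ Finset.range N, plateau ρ (ρ ^ k / ρ) (ρ ^ k) x = 1 := by
  rw [sum_range_plateau_of_one_le hρ N hx, psi_eq_one hρ ((div_le_one (by positivity)).2 hN)]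

/-- The partial sums vanish when `ρ^N ≤ x` (and `x ≥ 1`). [cite: ConreyIwaniec2002, §6 (6.27)] -/
theorem sum_range_plateau_eq_zero {ρ : ℝ} (hρ : 1 < ρ) {N : ℕ} {x : ℝ} (hx : 1 ≤ x)
    (hN : ρ ^ N ≤ x) : ∑ k ∈ Finset.range N, plateau ρ (ρ ^ k / ρ) (ρ ^ k) x = 0 := by
  rw [sum_range_plateau_of_one_le hρ N hx, psi_eq_zero hρ]
  rw [le_div_iff₀ (by positivity)]; nlinarith

/-- The partial sums tend to `1` (they are eventually equal to `1`) for `x ≥ 1`.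
[cite: ConreyIwaniec2002, §6 (6.27)] -/
theorem tendsto_sum_range_plateau {ρ : ℝ} (hρ : 1 < ρ) {x : ℝ} (hx : 1 ≤ x) :
    Tendsto (fun N => ∑ k ∈ Finset.range N, plateau ρ (ρ ^ k / ρ) (ρ ^ k) x) atTop (𝓝 1) := by
  refine tendsto_const_nhds.congr' ?_
  filter_upwards [(tendsto_pow_atTop_atTop_of_one_lt hρ).eventually_ge_atTop (ρ * x)] with N hN
  exact (sum_range_plateau_eq_one hρ hx hN).symm

/-! ### Scale-invariant derivative bounds -/

/-- **`|x|^m |plateau^{(m)}(x)| ≤ ρ²·D·(1 + (v/u)²)` for `m ≤ 2`, `0 < u ≤ v`**, with the constant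
`D = D(ρ)` of `exists_bound_iteratedDeriv_psi` (the derivatives of positive order live on
`[u, ρv]`, where `|x| ≤ ρv`). [cite: ConreyIwaniec2002, §6 (6.27); §4 (4.23)] -/
theorem plateau_bounds {ρ : ℝ} (hρ : 1 < ρ) :
    ∃ D : ℝ, 1 ≤ D ∧ ∀ u v : ℝ, 0 < u → u ≤ v → ∀ m : ℕ, m ≤ 2 → ∀ x : ℝ,
      |x| ^ m * |iteratedDeriv m (plateau ρ u v) x| ≤ ρ ^ 2 * D * (1 + (v / u) ^ 2) := by
  obtain ⟨D, hD1, hD⟩ := exists_bound_iteratedDeriv_psi hρ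
  refine ⟨D, hD1, fun u v hu huv m hm x => ?_⟩
  have hv : 0 < v := lt_of_lt_of_le hu huv
  have hr : 1 ≤ v / u := (one_le_div hu).2 huv
  have hρ1 : 1 ≤ ρ := hρ.le
  have hD0 : 0 ≤ D := by linarith
  have hRHS1 : (1 : ℝ) ≤ ρ ^ 2 * D * (1 + (v / u) ^ 2) := by
    have h1 : (1:ℝ) ≤ ρ ^ 2 := one_le_pow₀ hρ1
    have h2 : (1:ℝ) ≤ 1 + (v / u) ^ 2 := by nlinarith
    calc (1:ℝ) = 1 * 1 * 1 := by ring
      _ ≤ ρ ^ 2 * D * (1 + (v / u) ^ 2) :=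
        mul_le_mul (mul_le_mul h1 hD1 zero_le_one (by positivity)) h2 zero_le_one (by positivity)
  rcases Nat.eq_zero_or_pos m with rfl | hm0
  · rw [pow_zero, one_mul, iteratedDeriv_zero]
    exact (abs_plateau_le_one hρ hu huv x).trans hRHS1
  have hm' : m ≠ 0 := by omega
  by_cases hx : x ∈ Icc u (ρ * v)
  · -- on `[u, ρv]`: `|x| ≤ ρ v`
    have hx0 : 0 < x := lt_of_lt_of_le hu hx.1
    have hxle : |x| ≤ ρ * v := by rw [abs_of_pos hx0]; exact hx.2
    rw [iteratedDeriv_plateau ρ u v hm]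
    have hA : |iteratedDeriv m (psi ρ) (x / v) / v ^ m| ≤ D / v ^ m := by
      rw [abs_div, abs_of_pos (pow_pos hv m)]
      exact div_le_div_of_nonneg_right (hD m hm _) (pow_pos hv m).le
    have hB : |iteratedDeriv m (psi ρ) (x / u) / u ^ m| ≤ D / u ^ m := by
      rw [abs_div, abs_of_pos (pow_pos hu m)]
      exact div_le_div_of_nonneg_right (hD m hm _) (pow_pos hu m).le
    have hsub := (abs_sub _ _).trans (add_le_add hA hB)
    have hxm : |x| ^ m ≤ (ρ * v) ^ m := pow_le_pow_left₀ (abs_nonneg x) hxle m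
    calc |x| ^ m * |iteratedDeriv m (psi ρ) (x / v) / v ^ m - iteratedDeriv m (psi ρ) (x / u) / u ^ m|
        ≤ (ρ * v) ^ m * (D / v ^ m + D / u ^ m) :=
          mul_le_mul hxm hsub (abs_nonneg _) (by positivity)
      _ = ρ ^ m * D * (1 + (v / u) ^ m) := by
          rw [mul_pow, div_pow]; field_simp
      _ ≤ ρ ^ 2 * D * (1 + (v / u) ^ 2) := by
          have h1 : ρ ^ m ≤ ρ ^ 2 := pow_le_pow_right₀ hρ1 hm
          have h2 : (v / u) ^ m ≤ (v / u) ^ 2 := pow_le_pow_right₀ hr hm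
          have h3 : 0 ≤ 1 + (v / u) ^ m := by positivity
          calc ρ ^ m * D * (1 + (v / u) ^ m) ≤ ρ ^ 2 * D * (1 + (v / u) ^ m) :=
                mul_le_mul_of_nonneg_right (mul_le_mul_of_nonneg_right h1 hD0) h3
            _ ≤ ρ ^ 2 * D * (1 + (v / u) ^ 2) :=
                mul_le_mul_of_nonneg_left (by linarith) (by positivity)
  · -- off `[u, ρv]`: the derivative vanishes
    have hv' : x / v ∉ Icc 1 ρ := by
      intro hc
      rw [mem_Icc, le_div_iff₀ hv, div_le_iff₀ hv] at hc
      exact hx ⟨by linarith [hc.1], by linarith [hc.2]⟩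
    have hu' : x / u ∉ Icc 1 ρ := by
      intro hc
      rw [mem_Icc, le_div_iff₀ hu, div_le_iff₀ hu] at hc
      refine hx ⟨by linarith [hc.1], ?_⟩
      have : x ≤ ρ * u := hc.2
      nlinarith
    rw [iteratedDeriv_plateau ρ u v hm, iteratedDeriv_psi_eq_zero hρ hm' hv',
      iteratedDeriv_psi_eq_zero hρ hm' hu', zero_div, zero_div, sub_zero, abs_zero, mul_zero]
    exact le_trans zero_le_one hRHS1

end Thm61Partition

end ConreyIwaniec2002

end Literature.NumberTheory.LFunctions

end
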